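import Literature.AlgebraicGeometry.Resolution.FBlowup
import Literature.AlgebraicGeometry.Resolution.NormalizationOfVarieties
import Literature.AlgebraicGeometry.Resolution.NormalizationOfVarietiesProofs
import Literature.AlgebraicGeometry.Resolution.AlterationsDimension
import Literature.AlgebraicGeometry.Resolution.AlterationsModification
import Mathlib.AlgebraicGeometry.Noetherian
import HarnessLib

/-!
# Crux `WeightedThesis` (stmt-ResolutionOfSingularities-0569), line `kunz-tower-exceptional-defect`,
# stub `stub_stageZero_isRegular_of_dim_le_one`: the curve case of the termination stub

T. Yasuda, Amer. J. Math. 134 (2012) = arXiv:0706.2700, Cor. 2.8 (curves: the normalisation of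
an F-blowup of a curve is its regular model). In the tree's rendering: if `dim X₀ ≤ 1` and
`g : Y ⟶ X₀` is an `e`-th F-blowup (`IsFBlowup p e g`) of an integral scheme locally of finite
type over a perfect field `k` of characteristic `p`, then the first stage `Z ≅ Y^ν` of any
normalised F-blowup tower over `X₀` is already regular: (1) `X₀` is locally Noetherian, so `g` is
proper (`IsFBlowup.isProper`) and birational (`IsFBlowup.isBirational`), hence an alteration
(`IsBirational.isAlteration`); (2) alterations preserve the dimension
(`IsAlteration.topologicalKrullDim_eq`), so `dim Y ≤ 1`; (3) the normalisation of a variety of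
dimension `≤ 1` is regular (`isRegular_normalization_of_dim_le_one`, finiteness of integral
closure `NoetherFiniteIntegralClosure_holds`); (4) regularity transports along the isomorphism
`Z ≅ Y^ν` (`Scheme.IsRegular.of_isOpenImmersion`). Sources: [Yasuda2012] Cor. 2.6 and 2.8;
[DeJong1996] 2.20 and 4.3.
-/

noncomputable section

set_option linter.dupNamespace false -- mandated namespace of this single-conjunct summit

namespace Summit.ResolutionOfSingularities.ResolutionOfSingularities.Theorems.WeightedThesis.KunzTower

open CategoryTheory CategoryTheory.Limits AlgebraicGeometry TopologicalSpace
open Literature.AlgebraicGeometry.Resolution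

/-- **STUB `stub_stageZero_isRegular_of_dim_le_one` (the curve case of normalised F-blowup
towers; Yasuda 2012, Cor. 2.8).** For an integral scheme `X₀` locally of finite type over a
perfect field `k` of characteristic `p` with `dim X₀ ≤ 1`, an `e`-th F-blowup `g : Y ⟶ X₀` and
any `Z ≅ Y^ν`, the scheme `Z` is regular: `g` is proper birational, hence an alteration, so
`dim Y = dim X₀ ≤ 1`, and the normalisation of a variety of dimension `≤ 1` is regular
(Dedekind), transported along the isomorphism. [cite: Yasuda2012, Cor. 2.8; DeJong1996, 4.3] -/
theorem stub_stageZero_isRegular_of_dim_le_one :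
    ∀ (p : ℕ) [Fact p.Prime] (k : Type) [Field k] [CharP k p] [PerfectField k]
      (X₀ : Scheme.{0}) (f : X₀ ⟶ Spec (.of k)) [IsIntegral X₀] [LocallyOfFiniteType f]
      [CharP X₀.functionField p] (e : ℕ) (Z Y : Scheme.{0}) [IsIntegral Y] (g : Y ⟶ X₀)
      (_ : Z ≅ normalization Y), IsFBlowup p e g → topologicalKrullDim X₀ ≤ 1 →
      Scheme.IsRegular Z := by
  intro p _ k _ _ _ X₀ f _ _ _ e Z Y _ g i hg hdim
  haveI : IsLocallyNoetherian X₀ := LocallyOfFiniteType.isLocallyNoetherian f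
  haveI : IsProper g := hg.isProper
  -- `g` is a proper birational morphism onto an integral scheme: an alteration, so `dim Y ≤ 1`
  have hga : IsAlteration g := hg.isBirational.isAlteration
  have hdimY : topologicalKrullDim Y ≤ 1 := (hga.topologicalKrullDim_eq f).trans_le hdim
  -- the normalisation of the variety `Y / k` of dimension `≤ 1` is regular
  haveI : LocallyOfFiniteType (g ≫ f) := inferInstance
  have hreg : Scheme.IsRegular (normalization Y) :=
    isRegular_normalization_of_dim_le_one Y NoetherFiniteIntegralClosure_holds (g ≫ f) hdimY
  -- transport along `i : Z ≅ Y^ν`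
  exact Scheme.IsRegular.of_isOpenImmersion i.hom hreg

end Summit.ResolutionOfSingularities.ResolutionOfSingularities.Theorems.WeightedThesis.KunzTower

end
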